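import Literature.Analysis.Complex.FourierPolyaKiKimCounting
import Literature.Analysis.Complex.FourierPolyaKiKim
import HarnessLib

/-!
# Fourier critical points under multiplication by `x` (Ki–Kim 2000, Theorem 3.2, case `K = 0`)

Support file (real-variable part, 2/·) for the discharge of
`Literature.Analysis.Complex.KiKim2000_thm_4_3_noCriticalPoints`
(`Literature/Analysis/Complex/FourierPolyaKiKim.lean`). It rests on the critical-zero count
`Literature.Analysis.Complex.KiKim.fourK` of `FourierPolyaKiKimCounting.lean`.

Throughout, `H(g) := HasNoFourierCriticalPoint g` (the vendored rendering of "no derivative of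
`g` has a critical zero", Ki–Kim (1.1) with `k = 0` everywhere), for `g : ℝ → ℝ` analytic at
every point.

## Main results (all proved)

* Invariances of `H`: `noCrit_const_mul`, `noCrit_comp_neg`, `noCrit_deriv`, `noCrit_comp_add_const`;
  a non-zero polynomial never satisfies `H` (`not_noCrit_of_iteratedDeriv_eq_zero`), so under `H`
  no derivative vanishes identically (`iteratedDeriv_ne_zero_of_noCrit`).
* `sum_mul_succ_le_of_interleave` — the sign-interleaving inequality behind Ki–Kim (3.8).
* `noCrit_apply_of_noCrit_id_mul_of_nonneg`, `noCrit_of_noCrit_id_mul` — **Ki–Kim 2000, Theorem 3.2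
  and its Corollary in the case of no critical points**: if `t ↦ t ψ(t)` has no Fourier critical
  point then neither has `ψ` (the printed statement is the inequality
  `Σ_{λ≤l} K_{[0,a]}(ψ^{(λ)}) ≤ Σ_{λ≤l+1} K_{[0,a]}((tψ)^{(λ)})`, whose right side is `0` here). The
  proof is the printed one ((3.4)–(3.8)): on `[-ε, a+ε]` the level sums of `fourK` for `tψ` and
  `ψ` are compared through `N_{[0,a]}(tψ) = N_{[0,a]}(ψ) + 1`, Rolle with multiplicities for
  `t^{l+2} ψ^{(l+1)}` (whose derivative is `t^{l+1} (tψ)^{(l+2)}`), the coincidence of the signs of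
  `(tψ)^{(λ+1)}` and `ψ^{(λ)}` just left of `0`, and the interleaving of signs at `a + ε`; the
  difference is `≥ -2` and divisible by `4`.
* `noCrit_of_noCrit_sub_mul`, `noCrit_of_noCrit_one_sub_div_mul` — the same for factors `t - a`,
  `1 - t/a`.

## References

* H. Ki, Y.-O. Kim, Duke Math. J. 104 (2000) 45–73, §3: (3.3)–(3.8), Theorem 3.2 and Corollary,
  pp. 55–56 [KiKim2000].
-/

noncomputable section

open Filter Set Topology
open scoped Topology

namespace Literature.Analysis.Complex
namespace KiKim



section transfer

variable {g ψ : ℝ → ℝ}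

/-- `H` is invariant under multiplication by a non-zero constant. [folklore] -/
theorem noCrit_const_mul (hg : ∀ x, AnalyticAt ℝ g x) (h : HasNoFourierCriticalPoint g) {a : ℝ} (ha : a ≠ 0) :
    HasNoFourierCriticalPoint (fun t => a * g t) := by
  intro l c h1 h0
  have hd : ∀ n x, iteratedDeriv n (fun t => a * g t) x = a * iteratedDeriv n g x := fun n x =>
    iteratedDeriv_const_mul a ((hg x).contDiffAt.of_le le_top)
  simp only [hd] at h1 h0 ⊢
  have h1' : iteratedDeriv (l + 1) g c = 0 := (mul_eq_zero.mp h1).resolve_left ha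
  have h0' : iteratedDeriv l g c ≠ 0 := fun h' => h0 (by rw [h', mul_zero])
  have := h l c h1' h0'
  have ha2 : 0 < a * a := mul_self_pos.mpr ha
  nlinarith

/-- `H` is invariant under the reflection `t ↦ -t`. [folklore] -/
theorem noCrit_comp_neg (h : HasNoFourierCriticalPoint g) : HasNoFourierCriticalPoint (fun t => g (-t)) := by
  intro l c h1 h0
  simp only [iteratedDeriv_comp_neg, smul_eq_mul] at h1 h0 ⊢
  have h1' : iteratedDeriv (l + 1) g (-c) = 0 :=
    (mul_eq_zero.mp h1).resolve_left (pow_ne_zero _ (by norm_num))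
  have h0' : iteratedDeriv l g (-c) ≠ 0 := fun h' => h0 (by rw [h', mul_zero])
  have := h l (-c) h1' h0'
  have hp : ((-1 : ℝ) ^ l * iteratedDeriv l g (-c)) * ((-1) ^ (l + 2) * iteratedDeriv (l + 2) g (-c)) =
      iteratedDeriv l g (-c) * iteratedDeriv (l + 2) g (-c) := by
    rw [pow_add, show ((-1 : ℝ)) ^ 2 = 1 by norm_num]
    have : ((-1 : ℝ) ^ l) * (-1) ^ l = 1 := by rw [← mul_pow]; norm_num
    linear_combination (iteratedDeriv l g (-c) * iteratedDeriv (l + 2) g (-c)) * this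
  rw [hp]; exact this

/-- `H` passes to the derivative. [folklore] -/
theorem noCrit_deriv (h : HasNoFourierCriticalPoint g) : HasNoFourierCriticalPoint (deriv g) := by
  intro l c h1 h0
  simp only [← iteratedDeriv_succ'] at h1 h0 ⊢
  exact h (l + 1) c h1 h0

/-- `H` is invariant under translations. [folklore] -/
theorem noCrit_comp_add_const (h : HasNoFourierCriticalPoint g) (a : ℝ) : HasNoFourierCriticalPoint (fun t => g (t + a)) := by
  intro l c h1 h0
  simp only [iteratedDeriv_comp_add_const] at h1 h0 ⊢
  exact h l (c + a) h1 h0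

/-- A function one of whose derivatives vanishes identically while the previous one does not
vanish somewhere (a non-zero polynomial) has a (degenerate) Fourier critical point: `¬ H`. [folklore] -/
theorem not_noCrit_of_iteratedDeriv_eq_zero {d : ℕ} {c : ℝ} (h0 : iteratedDeriv d g c ≠ 0)
    (h1 : iteratedDeriv (d + 1) g = 0) : ¬ HasNoFourierCriticalPoint g := by
  intro h
  have h2 : iteratedDeriv (d + 2) g = 0 := by
    rw [show d + 2 = (d + 1) + 1 by ring, iteratedDeriv_succ, h1, deriv_zero]
  have := h d c (by rw [h1]; rfl) h0
  rw [h2] at this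
  simp at this

/-- Under `H`, no derivative of a non-zero (analytic) function vanishes identically. [folklore] -/
theorem iteratedDeriv_ne_zero_of_noCrit (h : HasNoFourierCriticalPoint g) (hg : g ≠ 0) (n : ℕ) : iteratedDeriv n g ≠ 0 := by
  induction n with
  | zero => simpa using hg
  | succ n ih =>
    intro hn
    obtain ⟨c, hc⟩ : ∃ c, iteratedDeriv n g c ≠ 0 := by
      by_contra hall; push Not at hall
      exact ih (funext fun x => by simpa using hall x)
    exact not_noCrit_of_iteratedDeriv_eq_zero hc hn h

/-- Iterated derivatives of `t ↦ t ψ(t)`: `(t ψ)^{(n+1)} = t ψ^{(n+1)} + (n+1) ψ^{(n)}`. [folklore] -/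
theorem iteratedDeriv_id_mul (hψ : ∀ x, AnalyticAt ℝ ψ x) (n : ℕ) (x : ℝ) :
    iteratedDeriv (n + 1) (fun t => t * ψ t) x =
      x * iteratedDeriv (n + 1) ψ x + (n + 1) * iteratedDeriv n ψ x := by
  have h1 : ContDiffAt ℝ (n + 1 : ℕ) (fun t : ℝ => t) x := contDiffAt_id
  have h2 : ContDiffAt ℝ (n + 1 : ℕ) ψ x := (hψ x).contDiffAt.of_le le_top
  have := iteratedDeriv_mul (n := n + 1) (x := x) h1 h2
  have hfun : ((fun t : ℝ => t) * ψ) = fun t => t * ψ t := rfl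
  rw [hfun] at this
  rw [this, Finset.sum_range_succ', Finset.sum_range_succ']
  simp only [iteratedDeriv_fun_id, Nat.choose_zero_right, Nat.cast_one, one_mul, Nat.sub_zero]
  rw [Finset.sum_eq_zero]
  · simp only [zero_add, Nat.choose_one_right, Nat.add_sub_cancel]
    simp
    ring
  · intro i _
    simp

/-- The zeroth case: `(t ψ)(x) = x ψ(x)` needs no lemma; all derivatives in one statement. [folklore] -/
theorem iteratedDeriv_id_mul' (hψ : ∀ x, AnalyticAt ℝ ψ x) (n : ℕ) (x : ℝ) :
    iteratedDeriv n (fun t => t * ψ t) x =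
      x * iteratedDeriv n ψ x + n * iteratedDeriv (n - 1) ψ x := by
  rcases n with _ | n
  · simp
  · rw [iteratedDeriv_id_mul hψ]; simp

/-! ## The sign-interleaving lemma (Ki–Kim 2000, (3.8)) -/

/-- **Interleaving.** If `x₀, …` and `y₀, …` are `±1`-sequences with `y₀ = x₀` and
`yᵢ ∈ {xᵢ, xᵢ₋₁}`, then `y` has at most as many sign changes as `x`:
`Σ_{i<n} xᵢ xᵢ₊₁ + (1 - yₙ xₙ) ≤ Σ_{i<n} yᵢ yᵢ₊₁` (the correction is `2·[yₙ ≠ xₙ]`). [cite: KiKim2000, (3.8)] -/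
theorem sum_mul_succ_le_of_interleave (x y : ℕ → ℤ) (hx : ∀ i, x i = 1 ∨ x i = -1)
    (h0 : y 0 = x 0) (hy : ∀ i, y (i + 1) = x (i + 1) ∨ y (i + 1) = x i) (n : ℕ) :
    ∑ i ∈ Finset.range n, x i * x (i + 1) + (1 - y n * x n) ≤
      ∑ i ∈ Finset.range n, y i * y (i + 1) := by
  induction n with
  | zero => rcases hx 0 with h | h <;> simp [h0, h]
  | succ n ih =>
    rw [Finset.sum_range_succ, Finset.sum_range_succ]
    have hyn : y n = x n ∨ y n = - x n := by
      rcases n with _ | n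
      · exact Or.inl h0
      · rcases hy n with h | h
        · exact Or.inl h
        · rw [h]
          rcases hx (n + 1) with h1 | h1 <;> rcases hx n with h2 | h2 <;> rw [h1, h2] <;> norm_num
    rcases hx n with hxn | hxn <;> rcases hx (n + 1) with hxn1 | hxn1 <;>
      rcases hyn with hyn | hyn <;> rcases hy n with hyn1 | hyn1 <;>
      simp only [hxn, hxn1, hyn, hyn1] at ih ⊢ <;> norm_num at ih ⊢ <;> omega

end transfer

section transferB

variable {ψ : ℝ → ℝ}

/-- `(F^{(n)})^{(j)} = F^{(n+j)}`. [folklore] -/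
theorem iteratedDeriv_iteratedDeriv (F : ℝ → ℝ) (n j : ℕ) :
    iteratedDeriv j (iteratedDeriv n F) = iteratedDeriv (n + j) F := by
  induction j with
  | zero => simp
  | succ j ih => rw [iteratedDeriv_succ, ih, ← iteratedDeriv_succ]; rfl

/-- Level sums from level `0`: `Σ_{i<n} fourK(F^{(i)}) = 2N(F^{(n)}) − 2N(F) − Σ_{i<n}(sᵢ(a) − sᵢ(b))`.
[cite: KiKim2000, (3.3)] -/
theorem sum_fourK_iteratedDeriv₀ (F : ℝ → ℝ) (a b : ℝ) (n : ℕ) :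
    ∑ i ∈ Finset.range n, fourK (iteratedDeriv i F) a b =
      2 * (zeroCount (iteratedDeriv n F) a b : ℤ) - 2 * (zeroCount F a b : ℤ) -
        ∑ i ∈ Finset.range n, (sFF (iteratedDeriv i F) a - sFF (iteratedDeriv i F) b) := by
  have := sum_fourK_iteratedDeriv F a b 0 n
  simp only [zero_add, iteratedDeriv_zero] at this
  exact this

/-- Zeros are isolated, in the form used to choose margins: eventually (as `ε → 0+`) the
punctured `ε`-neighbourhood of `p` is free of zeros. [folklore] -/
theorem eventually_nhdsGT_no_zero_near {G : ℝ → ℝ} (hG : ∀ x, AnalyticAt ℝ G x) (hne : G ≠ 0)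
    (p : ℝ) : ∀ᶠ ε in 𝓝[>] (0:ℝ), ∀ t, |t - p| ≤ ε → t ≠ p → G t ≠ 0 := by
  obtain ⟨δ, hδ, h⟩ := exists_ball_ne_zero hG hne p
  filter_upwards [Ioo_mem_nhdsGT hδ] with ε hε t ht htp
  exact h t (ht.trans_lt hε.2) htp

/-- The sign of a positive combination of two non-zero numbers is the sign of one of them
(when the combination is itself non-zero). [folklore] -/
theorem sign_pos_comb {a b u v w : ℝ} (ha : a ≠ 0) (hw : w ≠ 0) (hu : 0 < u) (hv : 0 < v)
    (h : w = u * a + v * b) :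
    SignType.sign w = SignType.sign a ∨ SignType.sign w = SignType.sign b := by
  rcases lt_trichotomy b 0 with hb' | hb' | hb'
  · rcases lt_or_gt_of_ne ha with ha' | ha'
    · left; rw [sign_neg ha', sign_neg (by rw [h]; nlinarith)]
    · rcases lt_or_gt_of_ne hw with hw' | hw'
      · right; rw [sign_neg hw', sign_neg hb']
      · left; rw [sign_pos hw', sign_pos ha']
  · left
    subst hb'
    rw [h, mul_zero, add_zero, sign_mul, sign_pos hu, one_mul]
  · rcases lt_or_gt_of_ne ha with ha' | ha'
    · rcases lt_or_gt_of_ne hw with hw' | hw'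
      · left; rw [sign_neg hw', sign_neg ha']
      · right; rw [sign_pos hw', sign_pos hb']
    · left; rw [sign_pos ha', sign_pos (by rw [h]; nlinarith)]

variable (hψ : ∀ x, AnalyticAt ℝ ψ x)
include hψ

/-- `t ↦ t ψ(t)` is analytic. [folklore] -/
theorem analyticAt_id_mul (x : ℝ) : AnalyticAt ℝ (fun t => t * ψ t) x :=
  (analyticAt_id.mul (hψ x))

/-- `t ψ(t) ≢ 0` when `ψ ≢ 0`. [folklore] -/
theorem id_mul_ne_zero (hψne : ψ ≠ 0) : (fun t => t * ψ t) ≠ 0 := by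
  intro h0
  obtain ⟨δ, hδ, hz⟩ := exists_ball_ne_zero hψ hψne 0
  have h1 := congr_fun h0 (δ / 2)
  simp only [Pi.zero_apply, mul_eq_zero] at h1
  rcases h1 with h1 | h1
  · linarith
  · exact hz (δ / 2) (by rw [sub_zero, abs_of_pos (by linarith)]; linarith) (by linarith) h1

/-- `ψ^{(n)} ≢ 0` from `H(tψ)` and `ψ ≢ 0`. [folklore] -/
theorem iteratedDeriv_ne_zero_of_noCrit_id_mul (hψne : ψ ≠ 0) (h : HasNoFourierCriticalPoint (fun t => t * ψ t))
    (n : ℕ) : iteratedDeriv n ψ ≠ 0 := by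
  have hφD := iteratedDeriv_ne_zero_of_noCrit h (id_mul_ne_zero hψ hψne)
  intro hn
  apply hφD (n + 1)
  funext x
  have hn1 : iteratedDeriv (n + 1) ψ = 0 := by rw [iteratedDeriv_succ, hn, deriv_zero]
  rw [iteratedDeriv_id_mul hψ, hn, hn1]
  simp

/-- **The orders and left signs of `(tψ)^{(μ+1)}` and `ψ^{(μ)}` at the origin agree**
(Ki–Kim 2000, (3.4)): `(tψ)^{(μ+1)} = t ψ^{(μ+1)} + (μ+1) ψ^{(μ)}` has, at `0`, the same order `q`
as `ψ^{(μ)}` with `q`-th derivative `(μ+1+q) ψ^{(μ+q)}(0)`. [cite: KiKim2000, (3.4)] -/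
theorem sgnL_iteratedDeriv_id_mul (hD : ∀ n, iteratedDeriv n ψ ≠ 0) (μ : ℕ) :
    analyticOrderAt (iteratedDeriv (μ + 1) (fun t => t * ψ t)) 0 ≠ ⊤ ∧
      sgnL (iteratedDeriv (μ + 1) (fun t => t * ψ t)) 0 = sgnL (iteratedDeriv μ ψ) 0 := by
  have hφ := analyticAt_id_mul hψ
  set G := iteratedDeriv μ ψ with hG
  set Φ := iteratedDeriv (μ + 1) (fun t => t * ψ t) with hΦ
  have hGa : ∀ x, AnalyticAt ℝ G x := analyticAt_iteratedDeriv hψ μ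
  have hΦa : ∀ x, AnalyticAt ℝ Φ x := analyticAt_iteratedDeriv hφ (μ + 1)
  have hGq : analyticOrderAt G 0 ≠ ⊤ := analyticOrderAt_ne_top_of_ne_zero hGa (hD μ) 0
  obtain ⟨q, hq⟩ := ENat.ne_top_iff_exists.mp hGq
  have hq' : analyticOrderAt G 0 = q := hq.symm
  have hder := (analyticOrderAt_eq_nat_iff_iteratedDeriv_eq_zero (hGa 0)).mp hq'
  -- the iterated derivatives of `Φ` at `0`
  have key : ∀ j, iteratedDeriv j Φ 0 = (μ + j + 1 : ℝ) * iteratedDeriv j G 0 := by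
    intro j
    rw [hΦ, hG, iteratedDeriv_iteratedDeriv, iteratedDeriv_iteratedDeriv,
      show μ + 1 + j = (μ + j) + 1 by ring, iteratedDeriv_id_mul hψ]
    push_cast
    ring
  have hΦq : analyticOrderAt Φ 0 = q := by
    rw [analyticOrderAt_eq_nat_iff_iteratedDeriv_eq_zero (hΦa 0)]
    refine ⟨fun j hj => ?_, ?_⟩
    · rw [key, hder.1 j hj, mul_zero]
    · rw [key]; exact mul_ne_zero (by positivity) hder.2
  refine ⟨by rw [hΦq]; exact ENat.coe_ne_top q, ?_⟩
  rw [sgnL_eq_sign_iteratedDeriv (hΦa 0) hΦq, sgnL_eq_sign_iteratedDeriv (hGa 0) hq', key, sign_mul,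
    sign_pos (by positivity : (0:ℝ) < (μ + q + 1 : ℝ)), one_mul]

/-- **Ki–Kim 2000, Theorem 3.2 (multiplication by `x`), case of no critical points, core at
points `c ≥ 0`:** if `t ↦ t ψ(t)` has no Fourier critical point, then `ψ` has none at any
`c ≥ 0`. (The printed theorem: `Σ_{λ≤l} K_{[0,a]}(ψ^{(λ)}) ≤ Σ_{λ≤l+1} K_{[0,a]}((tψ)^{(λ)})`; here
with right side `0`, via (3.5)–(3.8) on `[-ε, a+ε]`, `a = c`.) [cite: KiKim2000, Theorem 3.2] -/
theorem noCrit_apply_of_noCrit_id_mul_of_nonneg (hψne : ψ ≠ 0) (h : HasNoFourierCriticalPoint (fun t => t * ψ t))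
    (l : ℕ) {c : ℝ} (hc : 0 ≤ c) (h1 : iteratedDeriv (l + 1) ψ c = 0) (h0 : iteratedDeriv l ψ c ≠ 0) :
    iteratedDeriv l ψ c * iteratedDeriv (l + 2) ψ c < 0 := by
  set φ : ℝ → ℝ := fun t => t * ψ t with hφdef
  have hφ : ∀ x, AnalyticAt ℝ φ x := analyticAt_id_mul hψ
  have hψD : ∀ n, iteratedDeriv n ψ ≠ 0 := iteratedDeriv_ne_zero_of_noCrit_id_mul hψ hψne h
  have hφD : ∀ n, iteratedDeriv n φ ≠ 0 := iteratedDeriv_ne_zero_of_noCrit h (id_mul_ne_zero hψ hψne)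
  have hAψ : ∀ n x, AnalyticAt ℝ (iteratedDeriv n ψ) x := analyticAt_iteratedDeriv hψ
  have hAφ : ∀ n x, AnalyticAt ℝ (iteratedDeriv n φ) x := analyticAt_iteratedDeriv hφ
  /- Step 1: choice of the margin `ε`. -/
  have E1 : ∀ᶠ ε in 𝓝[>] (0:ℝ), ∀ n ∈ Finset.range (l + 4), ∀ t,
      (|t - 0| ≤ ε → t ≠ 0 → iteratedDeriv n ψ t ≠ 0) ∧ (|t - c| ≤ ε → t ≠ c → iteratedDeriv n ψ t ≠ 0) ∧
      (|t - 0| ≤ ε → t ≠ 0 → iteratedDeriv n φ t ≠ 0) ∧ (|t - c| ≤ ε → t ≠ c → iteratedDeriv n φ t ≠ 0) := by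
    rw [Finset.eventually_all]
    intro n _
    filter_upwards [eventually_nhdsGT_no_zero_near (hAψ n) (hψD n) 0,
      eventually_nhdsGT_no_zero_near (hAψ n) (hψD n) c,
      eventually_nhdsGT_no_zero_near (hAφ n) (hφD n) 0,
      eventually_nhdsGT_no_zero_near (hAφ n) (hφD n) c] with ε h1 h2 h3 h4 t
    exact ⟨h1 t, h2 t, h3 t, h4 t⟩
  have hneg : Tendsto (fun ε : ℝ => -ε) (𝓝[>] (0:ℝ)) (𝓝[<] (0:ℝ)) := by
    simpa using (tendsto_neg_nhdsGT_neg (a := (0:ℝ)))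
  have E2 : ∀ᶠ ε in 𝓝[>] (0:ℝ), ∀ n ∈ Finset.range (l + 3),
      SignType.sign (iteratedDeriv (n + 1) φ (-ε)) = SignType.sign (iteratedDeriv n ψ (-ε)) := by
    rw [Finset.eventually_all]
    intro n _
    obtain ⟨hq, hs⟩ := sgnL_iteratedDeriv_id_mul hψ hψD n
    have e1 := eventually_sign_eq_sgnL (hAφ (n + 1) 0) hq
    have e2 := eventually_sign_eq_sgnL (hAψ n 0) (analyticOrderAt_ne_top_of_ne_zero (hAψ n) (hψD n) 0)
    have e3 : ∀ᶠ t in 𝓝[<] (0:ℝ), SignType.sign (iteratedDeriv (n + 1) φ t) =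
        SignType.sign (iteratedDeriv n ψ t) := by
      filter_upwards [e1, e2] with t ht1 ht2
      rw [ht1, ht2, hs]
    exact hneg.eventually e3
  have E3 : ∀ᶠ ε in 𝓝[>] (0:ℝ), SignType.sign (φ (-ε) * deriv φ (-ε)) = -1 := by
    have hΦa : AnalyticAt ℝ (fun t => φ t * deriv φ t) 0 := (hφ 0).mul (hφ 0).deriv
    have hΦq : analyticOrderAt (fun t => φ t * deriv φ t) 0 ≠ ⊤ := by
      change analyticOrderAt (φ * deriv φ) 0 ≠ ⊤
      rw [analyticOrderAt_mul (hφ 0) (hφ 0).deriv]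
      have h1 := analyticOrderAt_ne_top_of_ne_zero hφ (hφD 0 ·) 0
      have h2 := analyticOrderAt_ne_top_of_ne_zero (fun x => (hφ x).deriv)
        (by rw [← iteratedDeriv_one]; exact hφD 1) 0
      exact WithTop.add_ne_top.mpr ⟨h1, h2⟩
    have e1 := eventually_sign_eq_sgnL hΦa hΦq
    rw [sgnL_mul_deriv_of_eq_zero (hφ 0) (analyticOrderAt_ne_top_of_ne_zero hφ (hφD 0 ·) 0)
      (by simp [hφdef])] at e1
    exact hneg.eventually e1
  obtain ⟨ε, ⟨hE1, hE2, hE3⟩, hε⟩ := ((E1.and (E2.and E3)).and self_mem_nhdsWithin).exists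
  change 0 < ε at hε
  /- Step 2: notation and the endpoint facts. -/
  set α : ℝ := -ε with hα
  set β : ℝ := c + ε with hβ
  have hαβ : α < β := by rw [hα, hβ]; linarith
  have hα0 : α < 0 := by rw [hα]; linarith
  have hcβ : c < β := by rw [hβ]; linarith
  have nzψα : ∀ n < l + 4, iteratedDeriv n ψ α ≠ 0 := fun n hn =>
    (hE1 n (Finset.mem_range.mpr hn) α).1 (by rw [hα]; simp [abs_of_pos hε]) hα0.ne
  have nzψβ : ∀ n < l + 4, iteratedDeriv n ψ β ≠ 0 := fun n hn =>
    (hE1 n (Finset.mem_range.mpr hn) β).2.1 (by rw [hβ]; simp [abs_of_pos hε]) hcβ.ne'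
  have nzφα : ∀ n < l + 4, iteratedDeriv n φ α ≠ 0 := fun n hn =>
    (hE1 n (Finset.mem_range.mpr hn) α).2.2.1 (by rw [hα]; simp [abs_of_pos hε]) hα0.ne
  have nzφβ : ∀ n < l + 4, iteratedDeriv n φ β ≠ 0 := fun n hn =>
    (hE1 n (Finset.mem_range.mpr hn) β).2.2.2 (by rw [hβ]; simp [abs_of_pos hε]) hcβ.ne'
  -- zero-free margins
  have mψ : ∀ n < l + 4, (∀ x ∈ Ico α 0, iteratedDeriv n ψ x ≠ 0) ∧
      (∀ x ∈ Ioc c β, iteratedDeriv n ψ x ≠ 0) := by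
    intro n hn
    refine ⟨fun x hx => (hE1 n (Finset.mem_range.mpr hn) x).1 ?_ hx.2.ne, fun x hx =>
      (hE1 n (Finset.mem_range.mpr hn) x).2.1 ?_ hx.1.ne'⟩
    · rw [sub_zero, abs_of_neg hx.2]; rw [hα] at hx; linarith [hx.1]
    · rw [abs_of_pos (by linarith [hx.1])]; rw [hβ] at hx; linarith [hx.2]
  have mφ : ∀ n < l + 4, (∀ x ∈ Ico α 0, iteratedDeriv n φ x ≠ 0) ∧
      (∀ x ∈ Ioc c β, iteratedDeriv n φ x ≠ 0) := by
    intro n hn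
    refine ⟨fun x hx => (hE1 n (Finset.mem_range.mpr hn) x).2.2.1 ?_ hx.2.ne, fun x hx =>
      (hE1 n (Finset.mem_range.mpr hn) x).2.2.2 ?_ hx.1.ne'⟩
    · rw [sub_zero, abs_of_neg hx.2]; rw [hα] at hx; linarith [hx.1]
    · rw [abs_of_pos (by linarith [hx.1])]; rw [hβ] at hx; linarith [hx.2]
  /- Step 3: the level sums. -/
  have Sφ := sum_fourK_iteratedDeriv₀ φ α β (l + 2)
  have Sψ := sum_fourK_iteratedDeriv₀ ψ α β (l + 1)
  -- `H(φ)` kills every term of `Sφ`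
  have Zφ : ∑ i ∈ Finset.range (l + 2), fourK (iteratedDeriv i φ) α β = 0 := by
    refine Finset.sum_eq_zero fun i hi => ?_
    have hi' := Finset.mem_range.mp hi
    refine (fourK_iteratedDeriv_nonneg_dvd_iff hφ i (hφD (i + 1)) hαβ (nzφα i (by omega))
      (nzφα (i + 1) (by omega)) (nzφβ i (by omega)) (nzφβ (i + 1) (by omega))).2.2.mpr ?_
    intro x _ hx1 hx0
    exact h i x hx1 hx0
  -- every term of `Sψ` is `≥ 0` and divisible by `4`
  have Pψ : ∀ i ∈ Finset.range (l + 1), 0 ≤ fourK (iteratedDeriv i ψ) α β ∧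
      4 ∣ fourK (iteratedDeriv i ψ) α β := by
    intro i hi
    have hi' := Finset.mem_range.mp hi
    have := fourK_iteratedDeriv_nonneg_dvd_iff hψ i (hψD (i + 1)) hαβ (nzψα i (by omega))
      (nzψα (i + 1) (by omega)) (nzψβ i (by omega)) (nzψβ (i + 1) (by omega))
    exact ⟨this.1, this.2.1⟩
  /- Step 4: the zero counts ((3.6) of Ki–Kim). -/
  have N1 : (zeroCount φ α β : ℤ) = 1 + zeroCount ψ α β := by
    have e1 : zeroCount φ α β = zeroCount φ 0 c :=
      zeroCount_eq_of_subset hφ (hφD 0 ·) hα0.le hcβ.le (by simpa using (mφ 0 (by omega)).1)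
        (by simpa using (mφ 0 (by omega)).2)
    have e2 : zeroCount ψ α β = zeroCount ψ 0 c :=
      zeroCount_eq_of_subset hψ hψne hα0.le hcβ.le (by simpa using (mψ 0 (by omega)).1)
        (by simpa using (mψ 0 (by omega)).2)
    have e3 : zeroCount φ 0 c = 1 + zeroCount ψ 0 c := by
      have := zeroCount_pow_mul hψ hψne 1 hc
      simpa [hφdef] using this
    rw [e1, e2, e3]; push_cast; ring
  have N2 : (zeroCount (iteratedDeriv (l + 1) ψ) α β : ℤ) ≤ zeroCount (iteratedDeriv (l + 2) φ) α β := by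
    -- `u = t^{l+2} ψ^{(l+1)}`, `u' = t^{l+1} φ^{(l+2)}`
    set u : ℝ → ℝ := fun t => t ^ (l + 2) * iteratedDeriv (l + 1) ψ t with hu
    set v : ℝ → ℝ := fun t => t ^ (l + 1) * iteratedDeriv (l + 2) φ t with hv
    have hua : ∀ x, AnalyticAt ℝ u x := fun x => by
      rw [hu]; exact (analyticAt_id.pow _).mul (hAψ _ x)
    have hduv : deriv u = v := by
      funext t
      have h2 : HasDerivAt (iteratedDeriv (l + 1) ψ) (iteratedDeriv (l + 2) ψ t) t := by
        have := (hAψ (l + 1) t).differentiableAt.hasDerivAt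
        rwa [deriv_iteratedDeriv] at this
      have hd := ((hasDerivAt_pow (l + 2) t).mul h2).deriv
      have e := iteratedDeriv_id_mul hψ (l + 1) t
      rw [show l + 1 + 1 = l + 2 from rfl] at e
      simp only [hu, hv, hφdef]
      rw [show (fun t => t ^ (l + 2) * iteratedDeriv (l + 1) ψ t) =
        (fun x : ℝ => x ^ (l + 2)) * iteratedDeriv (l + 1) ψ from rfl, hd, e,
        show l + 2 - 1 = l + 1 from rfl]
      push_cast
      ring
    have hune : u ≠ 0 := by
      intro h0'
      have : analyticOrderAt u 0 = ⊤ := by rw [h0']; exact analyticOrderAt_eq_top.mpr (by simp)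
      rw [hu, show (fun t : ℝ => t ^ (l + 2) * iteratedDeriv (l + 1) ψ t) =
        (fun t : ℝ => t ^ (l + 2)) * iteratedDeriv (l + 1) ψ from rfl,
        analyticOrderAt_mul (f := fun t : ℝ => t ^ (l + 2)) (by fun_prop) (hAψ _ 0),
        analyticOrderAt_pow_zero] at this
      exact absurd this (WithTop.add_ne_top.mpr ⟨ENat.coe_ne_top _,
        analyticOrderAt_ne_top_of_ne_zero (hAψ (l + 1)) (hψD (l + 1)) 0⟩)
    have hvne : deriv u ≠ 0 := by
      rw [hduv]
      intro h0'
      have : analyticOrderAt v 0 = ⊤ := by rw [h0']; exact analyticOrderAt_eq_top.mpr (by simp)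
      rw [hv, show (fun t : ℝ => t ^ (l + 1) * iteratedDeriv (l + 2) φ t) =
        (fun t : ℝ => t ^ (l + 1)) * iteratedDeriv (l + 2) φ from rfl,
        analyticOrderAt_mul (f := fun t : ℝ => t ^ (l + 1)) (by fun_prop) (hAφ _ 0),
        analyticOrderAt_pow_zero] at this
      exact absurd this (WithTop.add_ne_top.mpr ⟨ENat.coe_ne_top _,
        analyticOrderAt_ne_top_of_ne_zero (hAφ (l + 2)) (hφD (l + 2)) 0⟩)
    -- endpoint values of `u`, `u'`
    have hα0' : α ≠ 0 := hα0.ne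
    have hβ0' : β ≠ 0 := (hc.trans_lt hcβ).ne'
    have huα : u α ≠ 0 := mul_ne_zero (pow_ne_zero _ hα0') (nzψα (l + 1) (by omega))
    have huβ : u β ≠ 0 := mul_ne_zero (pow_ne_zero _ hβ0') (nzψβ (l + 1) (by omega))
    have hvα : deriv u α ≠ 0 := by
      rw [hduv]; exact mul_ne_zero (pow_ne_zero _ hα0') (nzφα (l + 2) (by omega))
    have hvβ : deriv u β ≠ 0 := by
      rw [hduv]; exact mul_ne_zero (pow_ne_zero _ hβ0') (nzφβ (l + 2) (by omega))
    have R := zeroCount_le_zeroCount_deriv_add_one hua hvne hαβ huα hvα huβ hvβ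
    -- evaluate both counts
    have eu : zeroCount u α β = (l + 2) + zeroCount (iteratedDeriv (l + 1) ψ) α β := by
      rw [zeroCount_eq_of_subset hua hune hα0.le hcβ.le, hu,
        zeroCount_pow_mul (hAψ (l + 1)) (hψD (l + 1)) (l + 2) hc,
        ← zeroCount_eq_of_subset (hAψ (l + 1)) (hψD (l + 1)) hα0.le hcβ.le (mψ (l + 1) (by omega)).1
          (mψ (l + 1) (by omega)).2]
      · intro x hx; exact mul_ne_zero (pow_ne_zero _ hx.2.ne) ((mψ (l + 1) (by omega)).1 x hx)
      · intro x hx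
        exact mul_ne_zero (pow_ne_zero _ (hc.trans_lt hx.1).ne') ((mψ (l + 1) (by omega)).2 x hx)
    have ev : zeroCount (deriv u) α β = (l + 1) + zeroCount (iteratedDeriv (l + 2) φ) α β := by
      have hva : ∀ x, AnalyticAt ℝ v x := fun x => by rw [hv]; exact (analyticAt_id.pow _).mul (hAφ _ x)
      rw [hduv, zeroCount_eq_of_subset hva (hduv ▸ hvne) hα0.le hcβ.le, hv,
        zeroCount_pow_mul (hAφ (l + 2)) (hφD (l + 2)) (l + 1) hc,
        ← zeroCount_eq_of_subset (hAφ (l + 2)) (hφD (l + 2)) hα0.le hcβ.le (mφ (l + 2) (by omega)).1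
          (mφ (l + 2) (by omega)).2]
      · intro x hx; exact mul_ne_zero (pow_ne_zero _ hx.2.ne) ((mφ (l + 2) (by omega)).1 x hx)
      · intro x hx
        exact mul_ne_zero (pow_ne_zero _ (hc.trans_lt hx.1).ne') ((mφ (l + 2) (by omega)).2 x hx)
    rw [eu, ev] at R
    push_cast at R
    linarith
  /- Step 5: the endpoint signs at `α = -ε` ((3.7) of Ki–Kim). -/
  have A1 : ∑ i ∈ Finset.range (l + 2), sFF (iteratedDeriv i φ) α =
      -1 + ∑ i ∈ Finset.range (l + 1), sFF (iteratedDeriv i ψ) α := by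
    rw [Finset.sum_range_succ' _ (l + 1)]
    have e0 : sFF (iteratedDeriv 0 φ) α = -1 := by
      unfold sFF
      rw [iteratedDeriv_zero]
      have := hE3
      rw [this]; rfl
    rw [e0, add_comm]
    congr 1
    refine Finset.sum_congr rfl fun i hi => ?_
    have hi' := Finset.mem_range.mp hi
    unfold sFF
    rw [deriv_iteratedDeriv, deriv_iteratedDeriv, sign_mul, sign_mul,
      hE2 i (Finset.mem_range.mpr (by omega)), hE2 (i + 1) (Finset.mem_range.mpr (by omega))]
  /- Step 6: the endpoint signs at `β = c + ε` ((3.8) of Ki–Kim, interleaving). -/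
  have A2 : ∑ i ∈ Finset.range (l + 1), sFF (iteratedDeriv i ψ) β - 1 ≤
      ∑ i ∈ Finset.range (l + 2), sFF (iteratedDeriv i φ) β := by
    set x : ℕ → ℤ := fun i => if i ≤ l + 2 then (SignType.sign (iteratedDeriv i ψ β) : ℤ) else 1
      with hx
    set y : ℕ → ℤ := fun i => if i ≤ l + 2 then (SignType.sign (iteratedDeriv i φ β) : ℤ) else 1
      with hy
    have hx1 : ∀ i, x i = 1 ∨ x i = -1 := by
      intro i
      simp only [hx]
      split_ifs with hi
      · exact signType_coe_int_eq_or _ (sign_ne_zero.mpr (nzψβ i (by omega)))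
      · exact Or.inl rfl
    have hy0 : y 0 = x 0 := by
      simp only [hx, hy, Nat.zero_le, if_true, iteratedDeriv_zero, hφdef, sign_mul,
        sign_pos (hc.trans_lt hcβ), one_mul]
    have hyx : ∀ i, y (i + 1) = x (i + 1) ∨ y (i + 1) = x i := by
      intro i
      simp only [hx, hy]
      by_cases hi : i + 1 ≤ l + 2
      · rw [if_pos hi, if_pos hi, if_pos (show i ≤ l + 2 by omega)]
        have hrel : iteratedDeriv (i + 1) φ β = β * iteratedDeriv (i + 1) ψ β +
            ((i : ℝ) + 1) * iteratedDeriv i ψ β := iteratedDeriv_id_mul hψ i β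
        rcases sign_pos_comb (nzψβ (i + 1) (by omega)) (nzφβ (i + 1) (by omega)) (hc.trans_lt hcβ)
          (by positivity) hrel with h' | h'
        · left; rw [h']
        · right; rw [h']
      · rw [if_neg hi]
        by_cases hi' : i ≤ l + 2
        · have : i = l + 2 := by omega
          subst this
          left; rw [if_neg (by omega)]
        · left; rw [if_neg (by omega)]
    have IL := sum_mul_succ_le_of_interleave x y hx1 hy0 hyx (l + 2)
    have hcorr : 0 ≤ 1 - y (l + 2) * x (l + 2) := by
      have hy1 : y (l + 2) = 1 ∨ y (l + 2) = -1 := by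
        simp only [hy, le_refl, if_true]
        exact signType_coe_int_eq_or _ (sign_ne_zero.mpr (nzφβ (l + 2) (by omega)))
      rcases hx1 (l + 2) with h1' | h1' <;> rcases hy1 with h2' | h2' <;> rw [h1', h2'] <;> norm_num
    have exx : ∑ i ∈ Finset.range (l + 2), x i * x (i + 1) =
        ∑ i ∈ Finset.range (l + 1), sFF (iteratedDeriv i ψ) β + x (l + 1) * x (l + 2) := by
      rw [Finset.sum_range_succ]
      congr 1
      refine Finset.sum_congr rfl fun i hi => ?_
      have hi' := Finset.mem_range.mp hi
      simp only [hx, sFF]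
      rw [if_pos (by omega), if_pos (by omega), deriv_iteratedDeriv, sign_mul, SignType.coe_mul]
    have eyy : ∑ i ∈ Finset.range (l + 2), y i * y (i + 1) =
        ∑ i ∈ Finset.range (l + 2), sFF (iteratedDeriv i φ) β := by
      refine Finset.sum_congr rfl fun i hi => ?_
      have hi' := Finset.mem_range.mp hi
      simp only [hy, sFF]
      rw [if_pos (by omega), if_pos (by omega), deriv_iteratedDeriv, sign_mul, SignType.coe_mul]
    have hlast : -1 ≤ x (l + 1) * x (l + 2) := by
      rcases hx1 (l + 1) with h1' | h1' <;> rcases hx1 (l + 2) with h2' | h2' <;> rw [h1', h2'] <;> norm_num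
    rw [exx, eyy] at IL
    linarith
  /- Step 7: conclusion — `Σ_{i ≤ l} fourK(ψ^{(i)}) ≤ 2`, hence `= 0`. -/
  have hsum_le : ∑ i ∈ Finset.range (l + 1), fourK (iteratedDeriv i ψ) α β ≤ 2 := by
    rw [Zφ] at Sφ
    rw [Sψ]
    rw [Finset.sum_sub_distrib] at Sφ ⊢
    rw [A1] at Sφ
    linarith [N1, N2, A2, Sφ]
  have hsum_nn : 0 ≤ ∑ i ∈ Finset.range (l + 1), fourK (iteratedDeriv i ψ) α β :=
    Finset.sum_nonneg fun i hi => (Pψ i hi).1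
  have hsum_dvd : (4 : ℤ) ∣ ∑ i ∈ Finset.range (l + 1), fourK (iteratedDeriv i ψ) α β :=
    Finset.dvd_sum fun i hi => (Pψ i hi).2
  have hsum0 : ∑ i ∈ Finset.range (l + 1), fourK (iteratedDeriv i ψ) α β = 0 := by omega
  have hl0 : fourK (iteratedDeriv l ψ) α β = 0 :=
    (Finset.sum_eq_zero_iff_of_nonneg fun i hi => (Pψ i hi).1).mp hsum0 l
      (Finset.mem_range.mpr (by omega))
  have key := (fourK_iteratedDeriv_nonneg_dvd_iff hψ l (hψD (l + 1)) hαβ (nzψα l (by omega))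
    (nzψα (l + 1) (by omega)) (nzψβ l (by omega)) (nzψβ (l + 1) (by omega))).2.2.mp hl0
  exact key c ⟨hα0.trans_le hc, hcβ⟩ h1 h0

end transferB

section transferB2

variable {ψ : ℝ → ℝ}

/-- **Ki–Kim 2000, Theorem 3.2 / Corollary, case `K = 0` (division by `x`):** if `ψ` is
real-analytic on `ℝ` and `t ↦ t ψ(t)` has no Fourier critical point, then neither has `ψ`.
(Printed: "if `f` has at least `K` critical points, then `(x − a) f(x)` also has at least `K`
critical points"; this is its contrapositive for `K = 1`, `a = 0`.) [cite: KiKim2000, Theorem 3.2 and Corollary] -/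
theorem noCrit_of_noCrit_id_mul (hψ : ∀ x, AnalyticAt ℝ ψ x) (h : HasNoFourierCriticalPoint (fun t => t * ψ t)) :
    HasNoFourierCriticalPoint ψ := by
  by_cases hψne : ψ = 0
  · intro l c _ h0
    exfalso; apply h0
    rw [hψne]
    simp
  intro l c h1 h0
  rcases le_or_gt 0 c with hc | hc
  · exact noCrit_apply_of_noCrit_id_mul_of_nonneg hψ hψne h l hc h1 h0
  · -- reflect: `ψ'(t) = ψ(-t)`, `t ψ'(t) = -((-t) ψ(-t))`
    set ψ' : ℝ → ℝ := fun t => ψ (-t) with hψ'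
    have hψ'a : ∀ x, AnalyticAt ℝ ψ' x := fun x =>
      (hψ (-x)).comp (f := fun t : ℝ => -t) (x := x) analyticAt_id.neg
    have hψ'ne : ψ' ≠ 0 := by
      intro h0'
      apply hψne
      funext t
      have := congr_fun h0' (-t)
      simpa [hψ'] using this
    have hφ' : HasNoFourierCriticalPoint (fun t => t * ψ' t) := by
      have hcn := noCrit_comp_neg h
      have han : ∀ x, AnalyticAt ℝ (fun t => (fun t => t * ψ t) (-t)) x := fun x =>
        (analyticAt_id_mul hψ (-x)).comp (f := fun t : ℝ => -t) (x := x) analyticAt_id.neg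
      have := noCrit_const_mul han hcn (a := -1) (by norm_num)
      convert this using 1
      funext t
      simp [hψ']
    have h1' : iteratedDeriv (l + 1) ψ' (-c) = 0 := by
      rw [hψ', iteratedDeriv_comp_neg, neg_neg, h1, smul_zero]
    have h0' : iteratedDeriv l ψ' (-c) ≠ 0 := by
      rw [hψ', iteratedDeriv_comp_neg, neg_neg, smul_eq_mul]
      exact mul_ne_zero (pow_ne_zero _ (by norm_num)) h0
    have key := noCrit_apply_of_noCrit_id_mul_of_nonneg hψ'a hψ'ne hφ' l (by linarith) h1' h0'
    rw [hψ', iteratedDeriv_comp_neg, iteratedDeriv_comp_neg, neg_neg, smul_eq_mul, smul_eq_mul] at key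
    have hp : ((-1 : ℝ) ^ l * iteratedDeriv l ψ c) * ((-1) ^ (l + 2) * iteratedDeriv (l + 2) ψ c) =
        iteratedDeriv l ψ c * iteratedDeriv (l + 2) ψ c := by
      rw [pow_add, show ((-1 : ℝ)) ^ 2 = 1 by norm_num]
      have : ((-1 : ℝ) ^ l) * (-1) ^ l = 1 := by rw [← mul_pow]; norm_num
      linear_combination (iteratedDeriv l ψ c * iteratedDeriv (l + 2) ψ c) * this
    rw [hp] at key
    exact key

/-- Division by a linear factor `t - a` preserves `H` (Ki–Kim 2000, Corollary to Thm 3.2 with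
`K = 1`, contrapositive). [cite: KiKim2000, Corollary to Theorem 3.2] -/
theorem noCrit_of_noCrit_sub_mul (hψ : ∀ x, AnalyticAt ℝ ψ x) (a : ℝ)
    (h : HasNoFourierCriticalPoint (fun t => (t - a) * ψ t)) : HasNoFourierCriticalPoint ψ := by
  -- translate: `ψ₁(t) = ψ(t + a)`, `t ψ₁(t) = ((t + a) - a) ψ(t + a)`
  have h1 : HasNoFourierCriticalPoint (fun t => t * ψ (t + a)) := by
    have := noCrit_comp_add_const h a
    convert this using 2
    simp
  have h2 := noCrit_of_noCrit_id_mul (fun x => (hψ (x + a)).comp (f := fun t : ℝ => t + a) (x := x)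
    (analyticAt_id.add analyticAt_const)) h1
  have h3 := noCrit_comp_add_const h2 (-a)
  convert h3 using 2
  simp

/-- Division by a factor `1 - t/a` (`a ≠ 0`) preserves `H`. [cite: KiKim2000, Corollary to Theorem 3.2] -/
theorem noCrit_of_noCrit_one_sub_div_mul (hψ : ∀ x, AnalyticAt ℝ ψ x) {a : ℝ} (ha : a ≠ 0)
    (h : HasNoFourierCriticalPoint (fun t => (1 - t / a) * ψ t)) : HasNoFourierCriticalPoint ψ := by
  have han : ∀ x, AnalyticAt ℝ (fun t => (1 - t / a) * ψ t) x := fun x => by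
    have := hψ x; fun_prop
  have h1 := noCrit_const_mul han h (a := -a) (neg_ne_zero.mpr ha)
  have h2 : HasNoFourierCriticalPoint (fun t => (t - a) * ψ t) := by
    convert h1 using 2 with t
    field_simp
    ring
  exact noCrit_of_noCrit_sub_mul hψ a h2

end transferB2

end KiKim
end Literature.Analysis.Complex
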